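import Mathlib
import HarnessLib
import Literature.MathematicalPhysics.StatisticalMechanics.PolymerNorms
import Literature.MathematicalPhysics.StatisticalMechanics.RenormalisationStepTranslation
import Literature.MathematicalPhysics.StatisticalMechanics.WeightedNormDominationSection
import Literature.MathematicalPhysics.StatisticalMechanics.RenormalisationStepLocality
import Literature.Dynamics.Hyperbolic.RGFlowStableManifoldReducedLipschitz

/-!
# The space of admissible polymer activities at scale `k` and its norm-bound predicate
# ([ABKM19] `M(𝓟_k^c)` with `‖K‖_k^{(A)}`; the `F k`, `Q k` of the fine-tuning engine)

The irrelevant coordinates `K_k` of the [ABKM19] flow are translation-invariant, local, `C^{r₀}`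
polymer activities with finite weak norm `‖K‖_k^{(A)}` ((6.48)–(6.50)).  In the tree the norm is the
predicate `WeakNormLE P k K C`; the fine-tuning engine
(`Literature.Dynamics.Hyperbolic.RGFlowStableManifoldReduced*`) consumes a family of additive groups
`F k` with norm-bound predicates `Q k` satisfying `RGFlow.IsSubaddNormBound`.  This file supplies them:

* `WeakNormLE.smul`, `WeakNormLE.neg` — homogeneity and symmetry of the predicate;
* **`activitySpace P k`** — the real submodule of activities `K : 𝓟 → (fields → ℂ)` that are `C^{r₀}`,
  `T_k^{X*}`-local on connected `k`-polymers, translation invariant on scale `k`, and of finite weak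
  norm (`∃ C, WeakNormLE P k K C`);
* **`activityNormLE P`** — `Q k K c := WeakNormLE P k K c` on `activitySpace P k`, and
  **`isSubaddNormBound_activityNormLE`** — it satisfies `RGFlow.IsSubaddNormBound` (`A > 0`);
* `integrable_comp_add_of_tayNormLE`, `integral_comp_add_add` — integrability of `ξ ↦ K(φ + ξ)`
  under a norm bound with section-dominated weight, and additivity of the fluctuation integral
  (the ingredients for bundling `B_k` as an additive map).

Everything is proved; no named fact.

## References
* S. Adams, S. Buchholz, R. Kotecký, S. Müller, arXiv:1910.13564, Ch. 6.4 (6.47)–(6.50), Ch. 12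
  (12.1)–(12.2) [AdamsBuchholzKoteckyMuller2019].
-/

noncomputable section

namespace Literature.MathematicalPhysics.StatisticalMechanics.GradientRG

open scoped BigOperators Classical
open Finset MeasureTheory
open Literature.MathematicalPhysics.StatisticalMechanics.TorusPolymer (IsPolymer numBlocks thicken)
open Literature.Barriers.CriticalPhenomena.LongRangePhi4.Polymer (IsConn)
open Literature.MathematicalPhysics.QuantumFieldTheory
open Literature.Dynamics.Hyperbolic

variable {d M : ℕ} [NeZero M]

/-! ## Homogeneity and symmetry of the weak-norm predicate -/

section TayNorm

variable {E V : Type*} [NormedAddCommGroup E] [NormedSpace ℝ E] [FiniteDimensional ℝ E]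
  [NormedAddCommGroup V] [NormedSpace ℝ V]
  {𝔸 : Type*} [NormedRing 𝔸] [NormedAlgebra ℝ 𝔸]

/-- `‖aK‖_{T,w} ≤ |a| C` for `‖K‖_{T,w} ≤ C` (`K` of class `C^{r₀}`).
[cite: AdamsBuchholzKoteckyMuller2019, Ch. 6.4 (6.47)] -/
theorem TayNormLE.smul {T : E →ₗ[ℝ] V} {r₀ : ℕ} {w : E → ℝ} {K : E → 𝔸} {C : ℝ}
    (h : TayNormLE T r₀ w K C) (hK : ContDiff ℝ r₀ K) (a : ℝ) :
    TayNormLE T r₀ w (a • K) (|a| * C) := fun φ => by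
  rw [tayNorm_smul T hK a φ, mul_assoc]
  exact mul_le_mul_of_nonneg_left (h φ) (abs_nonneg a)

end TayNorm

namespace WeakNormLE

variable {P : NormParams d M} {k : ℕ} {K : Finset (Fin d → ZMod M) → ((Fin d → ZMod M) → ℝ) → ℂ}
  {C : ℝ}

/-- **Homogeneity**: `‖aK‖_k^{(A)} ≤ |a| C`. [cite: AdamsBuchholzKoteckyMuller2019, Ch. 6.4 (6.50)] -/
theorem smul (h : WeakNormLE P k K C) (hK : ∀ X, ContDiff ℝ P.r₀ (K X)) (a : ℝ) :
    WeakNormLE P k (a • K) (|a| * C) := fun X hX hc => by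
  have := (h X hX hc).smul (hK X) a
  rw [mul_assoc]
  exact this

/-- **Symmetry**: `‖−K‖_k^{(A)} ≤ C`. [cite: AdamsBuchholzKoteckyMuller2019, Ch. 6.4 (6.50)] -/
theorem neg (h : WeakNormLE P k K C) (hK : ∀ X, ContDiff ℝ P.r₀ (K X)) : WeakNormLE P k (-K) C := by
  have := h.smul hK (-1)
  rw [neg_one_smul, abs_neg, abs_one, one_mul] at this
  exact this

/-- `‖K − K'‖ ≤ ‖K‖ + ‖K'‖`. [cite: AdamsBuchholzKoteckyMuller2019, Ch. 6.4 (6.50)] -/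
theorem sub {K' : Finset (Fin d → ZMod M) → ((Fin d → ZMod M) → ℝ) → ℂ} {C' : ℝ}
    (h : WeakNormLE P k K C) (h' : WeakNormLE P k K' C') (hK : ∀ X, ContDiff ℝ P.r₀ (K X))
    (hK' : ∀ X, ContDiff ℝ P.r₀ (K' X)) : WeakNormLE P k (K - K') (C + C') := by
  rw [sub_eq_add_neg]
  exact h.add (h'.neg hK') hK fun X => (hK' X).neg

end WeakNormLE

/-! ## The space of admissible activities -/

/-- **The admissible polymer activities at scale `k`** ([ABKM19] `M(𝓟_k^c)` with finite
`‖·‖_k^{(A)}`): `K(X, ·)` is `C^{r₀}` for every `X`, `T_k^{X*}`-local for every connected `k`-polymer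
`X`, `K` is translation invariant on scale `k` (`(L^kℤ)^d`), and `‖K‖_k^{(A)} < ∞`.  A real submodule
of all maps `𝓟 → (fields → ℂ)`. [cite: AdamsBuchholzKoteckyMuller2019, Ch. 6.4 (6.47)–(6.50)] -/
def activitySpace (P : NormParams d M) (k : ℕ) :
    Submodule ℝ (Finset (Fin d → ZMod M) → ((Fin d → ZMod M) → ℝ) → ℂ) where
  carrier := {K | (∀ X, ContDiff ℝ P.r₀ (K X)) ∧
    (∀ X, IsPolymer (P.L ^ k) X → IsConn X → IsGaugeLocal (P.gauge k X) (K X)) ∧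
    TransInv (P.L ^ k) K ∧ ∃ C, WeakNormLE P k K C}
  zero_mem' := by
    refine ⟨fun X => ?_, fun X _ _ => ?_, fun a _ X φ => rfl, ⟨0, WeakNormLE.zero⟩⟩
    · exact contDiff_const
    · exact IsGaugeLocal.const _ _
  add_mem' {K K'} hK hK' := by
    obtain ⟨hd, hl, ht, C, hC⟩ := hK
    obtain ⟨hd', hl', ht', C', hC'⟩ := hK'
    refine ⟨fun X => (hd X).add (hd' X), fun X hX hc => (hl X hX hc).add (hl' X hX hc),
      fun a ha X φ => ?_, ⟨C + C', hC.add hC' hd hd'⟩⟩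
    show K _ _ + K' _ _ = K X φ + K' X φ
    rw [ht a ha X φ, ht' a ha X φ]
  smul_mem' a {K} hK := by
    obtain ⟨hd, hl, ht, C, hC⟩ := hK
    refine ⟨fun X => (hd X).const_smul a, fun X hX hc => (hl X hX hc).smul a,
      fun b hb X φ => ?_, ⟨|a| * C, hC.smul hd a⟩⟩
    show a • K _ _ = a • K X φ
    rw [ht b hb X φ]

namespace activitySpace

variable {P : NormParams d M} {k : ℕ}

/-- Members are `C^{r₀}`. [cite: AdamsBuchholzKoteckyMuller2019, Ch. 6.4 (6.47)] -/
theorem contDiff (K : activitySpace P k) (X : Finset (Fin d → ZMod M)) :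
    ContDiff ℝ P.r₀ ((K : Finset (Fin d → ZMod M) → ((Fin d → ZMod M) → ℝ) → ℂ) X) := K.2.1 X

/-- Members are local on connected `k`-polymers. [cite: AdamsBuchholzKoteckyMuller2019, Ch. 6.4 (6.47)] -/
theorem isGaugeLocal (K : activitySpace P k) {X : Finset (Fin d → ZMod M)} (hX : IsPolymer (P.L ^ k) X)
    (hc : IsConn X) :
    IsGaugeLocal (P.gauge k X) ((K : Finset (Fin d → ZMod M) → ((Fin d → ZMod M) → ℝ) → ℂ) X) :=
  K.2.2.1 X hX hc

/-- Members are translation invariant on scale `k`. [cite: AdamsBuchholzKoteckyMuller2019, Lemma 6.4 (1)] -/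
theorem transInv (K : activitySpace P k) :
    TransInv (P.L ^ k) (K : Finset (Fin d → ZMod M) → ((Fin d → ZMod M) → ℝ) → ℂ) := K.2.2.2.1

/-- Members have finite weak norm. [cite: AdamsBuchholzKoteckyMuller2019, Ch. 6.4 (6.50)] -/
theorem exists_weakNormLE (K : activitySpace P k) :
    ∃ C, WeakNormLE P k (K : Finset (Fin d → ZMod M) → ((Fin d → ZMod M) → ℝ) → ℂ) C := K.2.2.2.2

/-- Membership from the four properties. [cite: AdamsBuchholzKoteckyMuller2019, Ch. 6.4 (6.50)] -/
theorem mem_of {K : Finset (Fin d → ZMod M) → ((Fin d → ZMod M) → ℝ) → ℂ}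
    (hd : ∀ X, ContDiff ℝ P.r₀ (K X))
    (hl : ∀ X, IsPolymer (P.L ^ k) X → IsConn X → IsGaugeLocal (P.gauge k X) (K X))
    (ht : TransInv (P.L ^ k) K) {C : ℝ} (hC : WeakNormLE P k K C) : K ∈ activitySpace P k :=
  ⟨hd, hl, ht, C, hC⟩

end activitySpace

/-! ## The norm-bound predicate on the activity spaces -/

/-- **`Q k K c := ‖K‖_k^{(A)} ≤ c`** on the admissible activities of scale `k`.
[cite: AdamsBuchholzKoteckyMuller2019, Ch. 12 (12.2)] -/
def activityNormLE (P : NormParams d M) (k : ℕ) (K : activitySpace P k) (c : ℝ) : Prop :=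
  WeakNormLE P k (K : Finset (Fin d → ZMod M) → ((Fin d → ZMod M) → ℝ) → ℂ) c

/-- **The weak-norm predicates satisfy the axioms of the fine-tuning engine**
(`RGFlow.IsSubaddNormBound`: monotone, `‖0‖ ≤ 0`, subadditive, symmetric), for `A > 0`.
[cite: AdamsBuchholzKoteckyMuller2019, Ch. 12 (12.2)] -/
theorem isSubaddNormBound_activityNormLE (P : NormParams d M) (hA : 0 < P.A) :
    RGFlow.IsSubaddNormBound (F := fun k => activitySpace P k) (activityNormLE P) where
  mono k K c c' h hcc' := WeakNormLE.mono h hA hcc'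
  zero k := WeakNormLE.zero
  add k K K' c c' h h' := by
    show WeakNormLE P k ((K : Finset (Fin d → ZMod M) → ((Fin d → ZMod M) → ℝ) → ℂ) + K') (c + c')
    exact WeakNormLE.add h h' (activitySpace.contDiff K) (activitySpace.contDiff K')
  neg k K c h := by
    show WeakNormLE P k (-(K : Finset (Fin d → ZMod M) → ((Fin d → ZMod M) → ℝ) → ℂ)) c
    exact WeakNormLE.neg h (activitySpace.contDiff K)

/-! ## Integrability and additivity of the fluctuation integral under a norm bound -/

section Fluct

variable {E V : Type*} [NormedAddCommGroup E] [NormedSpace ℝ E] [FiniteDimensional ℝ E]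
  [MeasurableSpace E] [OpensMeasurableSpace E] [NormedAddCommGroup V] [NormedSpace ℝ V]
  {𝔸 : Type*} [NormedRing 𝔸] [NormedAlgebra ℝ 𝔸]

/-- **`ξ ↦ K(φ + ξ)` is integrable** for a `T`-local `C^{r₀}` `K` with `‖K‖_{T,w} ≤ C` and `w`
section-dominated for `μ`. [cite: AdamsBuchholzKoteckyMuller2019, Lemma 8.4] -/
theorem integrable_comp_add_of_tayNormLE {T : E →ₗ[ℝ] V} {r₀ : ℕ} {w : E → ℝ} {K : E → 𝔸}
    {C : ℝ} {μ : Measure E} (h : TayNormLE T r₀ w K C) (hC : 0 ≤ C) (hK : ContDiff ℝ r₀ K)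
    (hloc : IsGaugeLocal T K) (hdom : WeightSectionDominated T w μ) (φ : E) :
    Integrable (fun ξ => K (φ + ξ)) μ := by
  have h1 := (h.derivDominated_section hC hK hdom).integrable_zero (T.rangeRestrict φ)
  refine h1.congr (ae_of_all _ fun ξ => ?_)
  show gaugeLift T K (T.rangeRestrict φ + T.rangeRestrict ξ) = K (φ + ξ)
  rw [← map_add, gaugeLift_rangeRestrict hloc]

omit [FiniteDimensional ℝ E] [OpensMeasurableSpace E] [NormedSpace ℝ E] in
/-- **Additivity of the fluctuation integral** under integrability:
`∫ (K + K')(φ + ξ) dμ = ∫ K(φ + ξ) dμ + ∫ K'(φ + ξ) dμ`. [cite: AdamsBuchholzKoteckyMuller2019, Ch. 6.1 (6.9)] -/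
theorem integral_comp_add_add {K K' : E → 𝔸} {μ : Measure E} (φ : E)
    (hK : Integrable (fun ξ => K (φ + ξ)) μ) (hK' : Integrable (fun ξ => K' (φ + ξ)) μ) :
    ∫ ξ, (K + K') (φ + ξ) ∂μ = ∫ ξ, K (φ + ξ) ∂μ + ∫ ξ, K' (φ + ξ) ∂μ := by
  simp only [Pi.add_apply]
  exact integral_add hK hK'

omit [FiniteDimensional ℝ E] [OpensMeasurableSpace E] [NormedSpace ℝ E] in
/-- Homogeneity of the fluctuation integral: `∫ (aK)(φ + ξ) dμ = a ∫ K(φ + ξ) dμ`.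
[cite: AdamsBuchholzKoteckyMuller2019, Ch. 6.1 (6.9)] -/
theorem integral_comp_add_smul {K : E → 𝔸} {μ : Measure E} (φ : E) (a : ℝ) :
    ∫ ξ, (a • K) (φ + ξ) ∂μ = a • ∫ ξ, K (φ + ξ) ∂μ := by
  simp only [Pi.smul_apply]
  exact integral_smul a _

end Fluct

end Literature.MathematicalPhysics.StatisticalMechanics.GradientRG

end
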